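import Mathlib
import Summits.HodgeConjecture.HodgeConjecture.Theorems.HodgeLocusCensusUnitColumnRankLevelsChar
import Summits.HodgeConjecture.HodgeConjecture.Theorems.HodgeLocusCensusInclusionPowersChar

/-!
# Hodge locus census — THEOREM L verbatim over every field of characteristic `p > k`

Certified instances and evidence bearing on the general Hodge conjecture; no claim.

Anchor 229 (`…UnitColumnRankLevelsPowers.rank_mulDeltaPow_levels`) computes, for `char K = 0`, the rank of
`×q^c : B_{k(e+1)−j−c(e+1)} → B_{k(e+1)−j}` (`B = K[x₁,…,x_k]/(xᵢ^{e+2})`, `q = Σ xᵢ^{e+1}`, `d = e + 3 ≥ 3`; rows / columns / entries in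
anchor 174's convention: entry = multiplicity of `ofFn v` in `(List.flatMap (colR (e+3)))^[c] [ofFn m]`) as
`Σ_μ [e+1 ∣ σ ∧ (e+1)s ≤ σ] · min (C(k−s,t), C(k−s,t+c))` (`σ = j + Σμ`, `s = #{μ ≠ 0}`, `t = σ/(e+1) − s`).

This file records that the SAME right-hand side is the rank over EVERY field of characteristic `p > k`
(`rank_mulDeltaPow_levels_of_lt_char`): by anchor 230's block decomposition (LW) `rank = Σ_μ [feasible] · rank_K (c! • W_{t,t+c}({x // μ x = 0}))`
over an arbitrary field, anchor 220's `rank_smul_of_ne_zero`, and anchor 231's Gottlieb–Kantor theorem in characteristic `p > n`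
(`rank_incl_pow_of_card_lt_char`) applied to the `k − s ≤ k < p` label-zero points; in the branch `(c! : K) = 0` the prime `p` divides `c!`, so
`p ≤ c`, hence `c > k ≥ k − s` and the block has no columns — both sides vanish.  Reading for the record: the positive-characteristic
exceptions table of the unit column at `k` variables is supported on the primes `p ≤ k`.
The same statement in anchor 222's membership form (`c = 1`, `rank_mulDelta_levels_of_lt_char`, through anchor 230's bridge
`mulDelta_levels_eq_reindex`) and with the hypothesis spelled `k < ringChar K` (`rank_mulDeltaPow_levels_of_lt_ringChar`) follow.

Imports `Mathlib` + anchors 230 (`…UnitColumnRankLevelsChar`) and 231 (`…InclusionPowersChar`) and uses anchor 220's `rank_smul_of_ne_zero`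
BY NAME; nothing restated; theorem-only, definition-free, `sorry`-free, no `decide`.
-/

set_option linter.dupNamespace false
set_option autoImplicit false

namespace Summit.HodgeConjecture.HodgeConjecture.HodgeLocus.Census.UnitColumnRankLevelsCharLarge

open Summit.HodgeConjecture.HodgeConjecture.HodgeLocus.Census.ModelNonJumpC1All (colR)
open Summit.HodgeConjecture.HodgeConjecture.HodgeLocus.Census.UnitColumnRankLevelsChar
  (rank_mulDeltaPow_levels_eq_sum mulDelta_levels_eq_reindex)
open Summit.HodgeConjecture.HodgeConjecture.HodgeLocus.Census.InclusionPowersChar (rank_incl_pow_of_card_lt_char)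
open Summit.HodgeConjecture.HodgeConjecture.HodgeLocus.Census.UnitColumnRankD3LevelsPowers (rank_smul_of_ne_zero)

/-- **THEOREM L verbatim over every field of characteristic `p > k`** (anchor 229's statement with `[CharZero K]` replaced by `[CharP K p]`, `k < p`):
the positive-characteristic exceptions table at `k` variables is supported on the primes `p ≤ k`. -/
theorem rank_mulDeltaPow_levels_of_lt_char (K : Type*) [Field K] (p : ℕ) [CharP K p] (k e c j : ℕ) (hkp : k < p) :
    (Matrix.of fun (v : {v : Fin k → Fin (e + 2) // (∑ i, (v i : ℕ)) + j = k * (e + 1)})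
        (m : {m : Fin k → Fin (e + 2) // (∑ i, (m i : ℕ)) + (j + c * (e + 1)) = k * (e + 1)}) =>
      ((((List.flatMap (colR (e + 3)))^[c] [List.ofFn (fun i => (m.1 i : ℕ))]).count (List.ofFn (fun i => (v.1 i : ℕ))) : ℕ) : K)).rank =
      ∑ μ : Fin k → Fin (e + 1),
        (if (e + 1) ∣ (j + ∑ i, (μ i : ℕ)) ∧ (e + 1) * (Finset.univ.filter (fun l => (μ l : ℕ) ≠ 0)).card ≤ j + ∑ i, (μ i : ℕ) then
            min ((k - (Finset.univ.filter (fun l => (μ l : ℕ) ≠ 0)).card).choose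
                  ((j + ∑ i, (μ i : ℕ)) / (e + 1) - (Finset.univ.filter (fun l => (μ l : ℕ) ≠ 0)).card))
              ((k - (Finset.univ.filter (fun l => (μ l : ℕ) ≠ 0)).card).choose
                  ((j + ∑ i, (μ i : ℕ)) / (e + 1) - (Finset.univ.filter (fun l => (μ l : ℕ) ≠ 0)).card + c))
          else 0) := by
  have hp : p.Prime := (CharP.char_is_prime_or_zero K p).resolve_right (by omega)
  rw [rank_mulDeltaPow_levels_eq_sum K k e c j]
  refine Finset.sum_congr rfl (fun μ _ => ?_)
  split_ifs with h
  · have hα : Fintype.card {x : Fin k // (μ x : ℕ) = 0} = k - (Finset.univ.filter (fun l => (μ l : ℕ) ≠ 0)).card := by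
      have h' := Finset.card_filter_add_card_filter_not (s := (Finset.univ : Finset (Fin k))) (fun l => (μ l : ℕ) = 0)
      rw [Fintype.card_subtype]
      simp only [Finset.card_univ, Fintype.card_fin, ne_eq] at h' ⊢
      omega
    by_cases hc : ((c.factorial : ℕ) : K) = 0
    · -- `p ∣ c!` forces `p ≤ c`, so `c > k ≥ k − s` and the block has no columns: both sides vanish
      have hpc : p ≤ c := (Nat.Prime.dvd_factorial hp).mp ((CharP.cast_eq_zero_iff K p _).mp hc)
      rw [hc, zero_smul, Matrix.rank_zero, eq_comm, Nat.min_eq_zero_iff]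
      right
      exact Nat.choose_eq_zero_of_lt (by omega)
    · rw [rank_smul_of_ne_zero _ _ hc, rank_incl_pow_of_card_lt_char K p (by rw [hα]; omega), hα]
  · rfl

/-- **Anchor 222's THEOREM L (`c = 1`, the membership matrix `rank_mulDelta_levels`) verbatim over every field of characteristic `p > k`**
(anchor 230's bridge `mulDelta_levels_eq_reindex` + the previous theorem at `c = 1`). -/
theorem rank_mulDelta_levels_of_lt_char (K : Type*) [Field K] (p : ℕ) [CharP K p] (k e j : ℕ) (hkp : k < p) :
    (Matrix.of fun (v : {v : Fin k → Fin (e + 2) // (∑ i, (v i : ℕ)) + j = k * (e + 1)})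
        (m : {m : Fin k → Fin (e + 2) // (∑ i, (m i : ℕ)) + (j + (e + 1)) = k * (e + 1)}) =>
      if List.ofFn (fun i => (v.1 i : ℕ)) ∈ colR (e + 3) (List.ofFn (fun i => (m.1 i : ℕ))) then (1 : K) else 0).rank =
      ∑ μ : Fin k → Fin (e + 1),
        (if (e + 1) ∣ (j + ∑ i, (μ i : ℕ)) ∧ (e + 1) * (Finset.univ.filter (fun l => (μ l : ℕ) ≠ 0)).card ≤ j + ∑ i, (μ i : ℕ) then
            min ((k - (Finset.univ.filter (fun l => (μ l : ℕ) ≠ 0)).card).choose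
                  ((j + ∑ i, (μ i : ℕ)) / (e + 1) - (Finset.univ.filter (fun l => (μ l : ℕ) ≠ 0)).card))
              ((k - (Finset.univ.filter (fun l => (μ l : ℕ) ≠ 0)).card).choose
                  ((j + ∑ i, (μ i : ℕ)) / (e + 1) - (Finset.univ.filter (fun l => (μ l : ℕ) ≠ 0)).card + 1))
          else 0) := by
  rw [mulDelta_levels_eq_reindex K k e j, Matrix.rank_reindex, rank_mulDeltaPow_levels_of_lt_char K p k e 1 j hkp]

/-- The same two statements with the hypothesis in the form «`p` prime, `k < p`» spelled through `ringChar` — no instance argument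
(convenient when `K` is given abstractly): characteristic `p > k` ⇒ THEOREM L's value. -/
theorem rank_mulDeltaPow_levels_of_lt_ringChar (K : Type*) [Field K] (k e c j : ℕ) (hkp : k < ringChar K) :
    (Matrix.of fun (v : {v : Fin k → Fin (e + 2) // (∑ i, (v i : ℕ)) + j = k * (e + 1)})
        (m : {m : Fin k → Fin (e + 2) // (∑ i, (m i : ℕ)) + (j + c * (e + 1)) = k * (e + 1)}) =>
      ((((List.flatMap (colR (e + 3)))^[c] [List.ofFn (fun i => (m.1 i : ℕ))]).count (List.ofFn (fun i => (v.1 i : ℕ))) : ℕ) : K)).rank =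
      ∑ μ : Fin k → Fin (e + 1),
        (if (e + 1) ∣ (j + ∑ i, (μ i : ℕ)) ∧ (e + 1) * (Finset.univ.filter (fun l => (μ l : ℕ) ≠ 0)).card ≤ j + ∑ i, (μ i : ℕ) then
            min ((k - (Finset.univ.filter (fun l => (μ l : ℕ) ≠ 0)).card).choose
                  ((j + ∑ i, (μ i : ℕ)) / (e + 1) - (Finset.univ.filter (fun l => (μ l : ℕ) ≠ 0)).card))
              ((k - (Finset.univ.filter (fun l => (μ l : ℕ) ≠ 0)).card).choose
                  ((j + ∑ i, (μ i : ℕ)) / (e + 1) - (Finset.univ.filter (fun l => (μ l : ℕ) ≠ 0)).card + c))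
          else 0) := by
  haveI : CharP K (ringChar K) := ringChar.charP K
  exact rank_mulDeltaPow_levels_of_lt_char K (ringChar K) k e c j hkp

end Summit.HodgeConjecture.HodgeConjecture.HodgeLocus.Census.UnitColumnRankLevelsCharLarge
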